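import Summits.CriticalPhenomena.PercolationContinuityZ3.Theorems.PercNearOneGluingAdditiveGluingGoodPocketMarkov
import Summits.CriticalPhenomena.PercolationContinuityZ3.Theorems.PercNearOneGluingAdditiveGluingPocketMarkov
import Summits.CriticalPhenomena.PercolationContinuityZ3.Theorems.PercNearOneGluingNoHeavyLowerTailCILConstReduction
import HarnessLib

/-!
# `NoHeavyLowerTail` (stmt-CriticalPhenomena-4575) — the CLUSTER-DELETION induction on `|A|`:
# one step inequality for an arbitrary potential closes the crux

Prover `prim-lf-5` (lemma factory #5, blob-quotient / deletion induction on `|A|`), gen 3, 2026-08-19;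
`--supports stmt-CriticalPhenomena-4575`.  No definitions, no named facts, no sorries.

Bond percolation `μ_w = prodBernoulli w` on `Fin n`, relays `A`, observer `o ∉ A`, level `j`,
`π(v) = {a ∈ A : v ↔ a}`, `N = |π(o)|`, `bad = μ_w{1 ≤ N ≤ j}`.  For a relay `y` and a vertex set `K ∋ y`,
`K ∌ o`, write `w ∖ K` for the weights with every pair meeting `K` set to `0` (the graph with `K` deleted; relays
`A ∖ K`).  The DOMAIN MARKOV PROPERTY of the product measure at the cluster of `y` gives the EXACT identity

  `bad(w, A) = μ_w{o ↔ y, |π(y)| ≤ j} + Σ_{K ∋ y, K ∌ o} μ_w{C(y) = K} · bad(w ∖ K, A ∖ K)`   (`(ID)`, any `y ∈ A`):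

either `o` lies in the cluster of `y` (then `π(o) = π(y)`), or the cluster `K = C(y)` misses `o`, and given
`{C(y) = K}` the configuration off `K` is a fresh percolation on the graph with `K` deleted.  Consequently, for
ANY potential `Ψ(w, A, o, j) ≥ 0` with `Ψ ≤ μ{|π(a)| ≤ j}` for some relay `a` (e.g. the PL-block / block-champion
bound `E[max_{c ∈ π(o)} μ{|π(c)| ≤ j}; N ≥ 1]`, or any other candidate of the cell), the ONE-STEP inequality

  `(STEP_C)  ∃ y ∈ A:  μ{o ↔ y, |π(y)| ≤ j} + C · Σ_{K ∋ y, K ∌ o} μ{C(y) = K} · Ψ(w ∖ K, A ∖ K) ≤ C · Ψ(w, A)`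

for all instances implies `bad ≤ C · Ψ ≤ C · μ{|π(a)| ≤ j}` by strong induction on `|A|` — the cumulative
isolation lemma WITH THE CONSTANT `C` — and hence the crux, by the landed
`noHeavyLowerTail_of_cumulativeIsolationConst_allLevels`.

* `ClusterDeletion.bad_subset` — the event decomposition behind `(ID)`;
* `ClusterDeletion.cluster_inter_bad_eq` — on `{C(y) = K}` (`o ∉ K`) the bad event of `(w, A)` is the bad event
  "inside `Kᶜ`" of `A ∖ K`, an event determined by the pairs inside `Kᶜ`;
* `ClusterDeletion.markov` — `μ_w({C(y) = K} ∩ bad(A)) = μ_w{C(y) = K} · bad(w ∖ K, A ∖ K)`;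
* `ClusterDeletion.bad_le_step` — the inequality form of `(ID)`;
* `cumulativeIsolationConst_of_clusterDeletionStep` — `(STEP_C) ⇒ ∃ a ∈ A, bad ≤ C · μ{|π(a)| ≤ j}`;
* `noHeavyLowerTail_of_clusterDeletionStep` — `(STEP_C) ⇒ NoHeavyLowerTail`.

Numerics and the status of concrete potentials (run/shared/lean/prim/prim-lf-5/CANDIDATES.md v7): with the loosest
T-form `max_c μ{o ↔ A, |π(c)| ≤ j}` the step is FALSE for every `C` (5-vertex witness); with the PL-block potential it
has 0 violations in ≈ 5·10³ exact instances + climbs (ttrl2 request `lf5-phid-cluster-deletion`).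
-/

namespace Summit.CriticalPhenomena.PercolationContinuityZ3.Theorems

open MeasureTheory Set
open Literature.Probability.LatticeModels (prodBernoulli prodBernoulli_real_inter_of_determinedBy_disjoint
  prodBernoulli_real_eq_of_determinedBy prodBernoulli_ae_forall_notMem)
open Literature.Probability.Percolation (BondConfig openConn openConnIn openGraph openCluster openGraph_adj
  DeterminedBy determinedBy_iff mem_openCluster_self)
open scoped BigOperators

noncomputable section
open Classical

variable {n : ℕ}

namespace ClusterDeletion

/-! ### Events -/

/-- On `{o ↔ y}` the relays joined to `o` are the relays joined to `y`. [folklore] -/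
theorem filter_eq_of_conn (A : Finset (Fin n)) {ω : BondConfig (Fin n)} {o y : Fin n}
    (h : ω ∈ openConn o y) :
    (A.filter fun x => ω ∈ openConn o x) = A.filter fun x => ω ∈ openConn y x :=
  (GuardedCIL.filter_eq_of_reachable A h).symm

/-- The open cluster of `y` as a `Finset`, and its defining property. [folklore] -/
theorem coe_clusterFinset (ω : BondConfig (Fin n)) (y : Fin n) :
    ((Finset.univ.filter fun v : Fin n => (openGraph ω).Reachable y v : Finset (Fin n)) : Set (Fin n)) =
      openCluster ω y := by
  ext v
  simp only [Finset.coe_filter, Finset.mem_univ, true_and, Set.mem_setOf_eq]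
  rfl

/-- **Event decomposition behind `(ID)`.**  For `y ∈ A` (any vertex `y`, in fact): the bad event
`{1 ≤ N ≤ j}` is covered by `{o ↔ y, |π(y)| ≤ j}` and the events `{C(y) = K} ∩ {1 ≤ N ≤ j}` over the vertex
sets `K ∋ y`, `K ∌ o`. [folklore] -/
theorem bad_subset (A : Finset (Fin n)) (o y : Fin n) (j : ℕ) :
    {ω : BondConfig (Fin n) | 1 ≤ (A.filter fun x => ω ∈ openConn o x).card ∧
        (A.filter fun x => ω ∈ openConn o x).card ≤ j} ⊆
      (openConn o y ∩ {ω | (A.filter fun x => ω ∈ openConn y x).card ≤ j}) ∪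
        ⋃ K ∈ (Finset.univ : Finset (Finset (Fin n))).filter (fun K => y ∈ K ∧ o ∉ K),
          ({ω : BondConfig (Fin n) | openCluster ω y = (K : Set (Fin n))} ∩
            {ω | 1 ≤ (A.filter fun x => ω ∈ openConn o x).card ∧
              (A.filter fun x => ω ∈ openConn o x).card ≤ j}) := by
  intro ω hω
  by_cases hoy : ω ∈ openConn o y
  · left
    refine ⟨hoy, ?_⟩
    have h2 := hω.2
    rw [filter_eq_of_conn A hoy] at h2
    exact h2
  · right
    set K : Finset (Fin n) := Finset.univ.filter fun v : Fin n => (openGraph ω).Reachable y v with hK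
    have hyK : y ∈ K := Finset.mem_filter.2 ⟨Finset.mem_univ _, SimpleGraph.Reachable.refl y⟩
    have hoK : o ∉ K := by
      intro h
      have hyo : (openGraph ω).Reachable y o := (Finset.mem_filter.1 h).2
      exact hoy hyo.symm
    refine Set.mem_iUnion₂.2 ⟨K, Finset.mem_filter.2 ⟨Finset.mem_univ _, hyK, hoK⟩, ?_, hω⟩
    show openCluster ω y = (K : Set (Fin n))
    rw [hK, coe_clusterFinset]

/-- On `{C(y) = K}` with `o ∉ K`, an open path from `o` never meets `K` (it would put `o` in the cluster of
`y`): `o ↔ a ↔ (o ↔ a inside Kᶜ)`. [folklore] -/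
theorem openConn_iff_openConnIn_of_cluster_eq {K : Finset (Fin n)} {ω : BondConfig (Fin n)} {o y : Fin n}
    (hK : openCluster ω y = (K : Set (Fin n))) (hoK : o ∉ K) (a : Fin n) :
    ω ∈ openConn o a ↔ ω ∈ openConnIn ((K : Set (Fin n))ᶜ) o a := by
  refine ⟨fun hoa => ?_, fun h =>
    Literature.Probability.Percolation.DCT16.reachable_of_pathIn
      (Literature.Probability.Percolation.DCT16.pathIn_of_mem_openConnIn h)⟩
  -- every vertex reachable from `o` lies outside `K`
  have hout : ∀ z : Fin n, (openGraph ω).Reachable o z → z ∈ ((K : Set (Fin n))ᶜ) := by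
    intro z hz hzK
    have hzK' : z ∈ openCluster ω y := by rw [hK]; exact hzK
    have hyz : (openGraph ω).Reachable y z := hzK'
    have hyo : (openGraph ω).Reachable y o := hyz.trans hz.symm
    have : o ∈ openCluster ω y := hyo
    rw [hK] at this
    exact hoK (Finset.mem_coe.1 this)
  apply Literature.Probability.Percolation.DCT16.mem_openConnIn_of_pathIn
  have hr : (openGraph ω).Reachable o a := hoa
  rw [SimpleGraph.reachable_iff_reflTransGen] at hr
  refine ⟨hout o (SimpleGraph.Reachable.refl o), ?_⟩
  clear hoa
  induction hr with
  | refl => exact Relation.ReflTransGen.refl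
  | @tail x z hox hxz ih =>
    exact ih.tail ⟨hxz, hout z ((SimpleGraph.reachable_iff_reflTransGen _ _).2 (hox.tail hxz))⟩

/-- On `{C(y) = K}` (`o ∉ K`) the relays joined to `o` are the relays of `A ∖ K` joined to `o` inside `Kᶜ`.
[folklore] -/
theorem filter_eq_of_cluster_eq (A : Finset (Fin n)) {K : Finset (Fin n)} {ω : BondConfig (Fin n)}
    {o y : Fin n} (hK : openCluster ω y = (K : Set (Fin n))) (hoK : o ∉ K) :
    (A.filter fun x => ω ∈ openConn o x) =
      (A \ K).filter fun x => ω ∈ openConnIn ((K : Set (Fin n))ᶜ) o x := by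
  ext a
  simp only [Finset.mem_filter, Finset.mem_sdiff]
  constructor
  · rintro ⟨haA, hoa⟩
    have h' := (openConn_iff_openConnIn_of_cluster_eq hK hoK a).1 hoa
    refine ⟨⟨haA, fun haK => ?_⟩, h'⟩
    obtain ⟨-, ha, -⟩ := h'
    exact ha (Finset.mem_coe.2 haK)
  · rintro ⟨⟨haA, -⟩, h⟩
    exact ⟨haA, (openConn_iff_openConnIn_of_cluster_eq hK hoK a).2 h⟩

/-- **The bad event on a cluster event.**  For `o ∉ K`:
`{C(y) = K} ∩ {1 ≤ N_A ≤ j} = {C(y) = K} ∩ {1 ≤ N' ≤ j}` with `N'` the number of relays of `A ∖ K` joined to `o`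
inside `Kᶜ`. [folklore] -/
theorem cluster_inter_bad_eq (A K : Finset (Fin n)) (o y : Fin n) (j : ℕ) (hoK : o ∉ K) :
    {ω : BondConfig (Fin n) | openCluster ω y = (K : Set (Fin n))} ∩
        {ω | 1 ≤ (A.filter fun x => ω ∈ openConn o x).card ∧
          (A.filter fun x => ω ∈ openConn o x).card ≤ j} =
      {ω : BondConfig (Fin n) | openCluster ω y = (K : Set (Fin n))} ∩
        {ω | 1 ≤ ((A \ K).filter fun x => ω ∈ openConnIn ((K : Set (Fin n))ᶜ) o x).card ∧
          ((A \ K).filter fun x => ω ∈ openConnIn ((K : Set (Fin n))ᶜ) o x).card ≤ j} := by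
  ext ω
  simp only [Set.mem_inter_iff, Set.mem_setOf_eq]
  constructor
  · rintro ⟨hK, h⟩
    rw [filter_eq_of_cluster_eq A hK hoK] at h
    exact ⟨hK, h⟩
  · rintro ⟨hK, h⟩
    rw [← filter_eq_of_cluster_eq A hK hoK] at h
    exact ⟨hK, h⟩

/-- The "bad inside `Kᶜ`" event is determined by the pairs inside `Kᶜ`. [folklore] -/
theorem determinedBy_badIn (A K : Finset (Fin n)) (o : Fin n) (j : ℕ) :
    DeterminedBy
      {ω : BondConfig (Fin n) |
        1 ≤ ((A \ K).filter fun x => ω ∈ openConnIn ((K : Set (Fin n))ᶜ) o x).card ∧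
          ((A \ K).filter fun x => ω ∈ openConnIn ((K : Set (Fin n))ᶜ) o x).card ≤ j}
      (↑(Finset.univ.filter fun e : Sym2 (Fin n) => ∀ x ∈ e, x ∉ K) : Set (Sym2 (Fin n))) := by
  have hsub : ((K : Set (Fin n))ᶜ).sym2 ⊆
      (↑(Finset.univ.filter fun e : Sym2 (Fin n) => ∀ x ∈ e, x ∉ K) : Set (Sym2 (Fin n))) := by
    intro e he
    rw [Finset.coe_filter]
    refine ⟨Finset.mem_univ _, fun x hx hxK => ?_⟩
    exact Set.mem_sym2_iff_subset.1 he hx (Finset.mem_coe.2 hxK)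
  rw [determinedBy_iff]
  intro ω ω' h
  have hfilt : ((A \ K).filter fun x => ω ∈ openConnIn ((K : Set (Fin n))ᶜ) o x) =
      (A \ K).filter fun x => ω' ∈ openConnIn ((K : Set (Fin n))ᶜ) o x := by
    refine Finset.filter_congr fun x _ => ?_
    exact (determinedBy_iff _ _).1
      (Literature.Probability.Percolation.DCT16.determinedBy_openConnIn ((K : Set (Fin n))ᶜ) o x hsub) ω ω' h
  simp only [Set.mem_setOf_eq, hfilt]

/-- **Domain Markov identity at the cluster of `y`.**  For `y ∈ K`, `o ∉ K`:
`μ_w({C(y) = K} ∩ {1 ≤ N_A ≤ j}) = μ_w{C(y) = K} · μ_{w ∖ K}{1 ≤ N_{A∖K} ≤ j}`, where `w ∖ K` gives weight `0` to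
every pair meeting `K`: `{C(y) = K}` is determined by the pairs meeting `K`, the bad event inside `Kᶜ` by the pairs
inside `Kᶜ` (independent under the product measure, same law under `w` and `w ∖ K`), and under `w ∖ K` the pairs
meeting `K` are a.s. closed, so there `o ↔ a ↔ (o ↔ a inside Kᶜ)` and no relay of `K` is joined to `o`.
[folklore; Kozma–Nitzan arXiv:2401.12397 proof of Thm 5; van den Berg–Häggström–Kahn 2006 Lemma 2.3] -/
theorem markov (w : Sym2 (Fin n) → unitInterval) (A K : Finset (Fin n)) (o y : Fin n) (j : ℕ)
    (hyK : y ∈ K) (hoK : o ∉ K) :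
    (prodBernoulli w).real
        ({ω : BondConfig (Fin n) | openCluster ω y = (K : Set (Fin n))} ∩
          {ω | 1 ≤ (A.filter fun x => ω ∈ openConn o x).card ∧
            (A.filter fun x => ω ∈ openConn o x).card ≤ j}) =
      (prodBernoulli w).real {ω : BondConfig (Fin n) | openCluster ω y = (K : Set (Fin n))} *
        (prodBernoulli (fun e : Sym2 (Fin n) => if ∃ v ∈ K, v ∈ e then (0 : unitInterval) else w e)).real
          {ω : BondConfig (Fin n) | 1 ≤ ((A \ K).filter fun x => ω ∈ openConn o x).card ∧
            ((A \ K).filter fun x => ω ∈ openConn o x).card ≤ j} := by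
  set w' : Sym2 (Fin n) → unitInterval :=
    fun e : Sym2 (Fin n) => if ∃ v ∈ K, v ∈ e then (0 : unitInterval) else w e with hw'
  set P : Set (BondConfig (Fin n)) := {ω | openCluster ω y = (K : Set (Fin n))} with hP
  set E : Set (BondConfig (Fin n)) :=
    {ω | 1 ≤ ((A \ K).filter fun x => ω ∈ openConnIn ((K : Set (Fin n))ᶜ) o x).card ∧
      ((A \ K).filter fun x => ω ∈ openConnIn ((K : Set (Fin n))ᶜ) o x).card ≤ j} with hE
  set F : Finset (Sym2 (Fin n)) := Finset.univ.filter fun e : Sym2 (Fin n) => ∃ x ∈ K, x ∈ e with hF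
  set F' : Finset (Sym2 (Fin n)) := Finset.univ.filter fun e : Sym2 (Fin n) => ∀ x ∈ e, x ∉ K with hF'
  have hdisj : Disjoint F F' := by
    rw [Finset.disjoint_left]
    intro e he he'
    obtain ⟨x, hxK, hxe⟩ := (Finset.mem_filter.1 he).2
    exact (Finset.mem_filter.1 he').2 x hxe hxK
  have hPdet : DeterminedBy P (↑F : Set (Sym2 (Fin n))) := goodPM_determinedBy_cluster_eq y K hyK
  have hEdet : DeterminedBy E (↑F' : Set (Sym2 (Fin n))) := determinedBy_badIn A K o j
  rw [cluster_inter_bad_eq A K o y j hoK]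
  -- (1) independence
  have step1 : (prodBernoulli w).real (P ∩ E) = (prodBernoulli w).real P * (prodBernoulli w).real E :=
    prodBernoulli_real_inter_of_determinedBy_disjoint w hdisj hPdet hEdet (Set.toFinite _).measurableSet
      (Set.toFinite _).measurableSet
  -- (2) same law of `E` under `w` and `w'`
  have step2 : (prodBernoulli w).real E = (prodBernoulli w').real E := by
    refine prodBernoulli_real_eq_of_determinedBy w w' (F := (↑F' : Set (Sym2 (Fin n)))) (fun e he => ?_)
      hEdet (Set.toFinite _).measurableSet
    have he' : ∀ x ∈ e, x ∉ K := (Finset.mem_filter.1 (Finset.mem_coe.1 he)).2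
    have hne : ¬ ∃ v ∈ K, v ∈ e := fun ⟨v, hvK, hve⟩ => he' v hve hvK
    simp only [hw', if_neg hne]
  change (prodBernoulli w).real (P ∩ E) = (prodBernoulli w).real P * _
  rw [step1, step2]
  congr 1
  -- (3) under `w'` the pairs meeting `K` are a.s. closed: `E` = the plain bad event of `A ∖ K`
  apply measureReal_congr
  have hae : ∀ᵐ ω ∂prodBernoulli w', ∀ e ∈ (↑F : Set (Sym2 (Fin n))), e ∉ ω := by
    refine prodBernoulli_ae_forall_notMem w' F.countable_toSet fun e he => ?_
    have he' : ∃ x ∈ K, x ∈ e := (Finset.mem_filter.1 (Finset.mem_coe.1 he)).2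
    simp only [hw', if_pos he']
  refine Filter.eventuallyEq_set.2 ?_
  filter_upwards [hae] with ω hω
  have hω' : ∀ x ∈ K, ∀ z : Fin n, s(x, z) ∉ ω := fun x hx z =>
    hω _ (Finset.mem_coe.2 (Finset.mem_filter.2 ⟨Finset.mem_univ _, x, hx, Sym2.mem_mk_left x z⟩))
  have hfilt : ((A \ K).filter fun x => ω ∈ openConnIn ((K : Set (Fin n))ᶜ) o x) =
      (A \ K).filter fun x => ω ∈ openConn o x := by
    refine Finset.filter_congr fun x _ => ?_
    exact (pocketMarkov_openConn_iff_openConnIn_of_closed hω' hoK x).symm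
  simp only [hE, Set.mem_setOf_eq, hfilt]

/-- **The inequality form of `(ID)`.**  For any relay `y`:
`bad(w, A) ≤ μ_w{o ↔ y, |π(y)| ≤ j} + Σ_{K ∋ y, K ∌ o} μ_w{C(y) = K} · bad(w ∖ K, A ∖ K)`. [folklore] -/
theorem bad_le_step (w : Sym2 (Fin n) → unitInterval) (A : Finset (Fin n)) (o y : Fin n) (j : ℕ) :
    (prodBernoulli w).real {ω : BondConfig (Fin n) |
        1 ≤ (A.filter fun x => ω ∈ openConn o x).card ∧ (A.filter fun x => ω ∈ openConn o x).card ≤ j} ≤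
      (prodBernoulli w).real (openConn o y ∩ {ω | (A.filter fun x => ω ∈ openConn y x).card ≤ j}) +
        ∑ K ∈ (Finset.univ : Finset (Finset (Fin n))).filter (fun K => y ∈ K ∧ o ∉ K),
          (prodBernoulli w).real {ω : BondConfig (Fin n) | openCluster ω y = (K : Set (Fin n))} *
            (prodBernoulli (fun e : Sym2 (Fin n) => if ∃ v ∈ K, v ∈ e then (0 : unitInterval) else w e)).real
              {ω : BondConfig (Fin n) | 1 ≤ ((A \ K).filter fun x => ω ∈ openConn o x).card ∧
                ((A \ K).filter fun x => ω ∈ openConn o x).card ≤ j} := by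
  refine (measureReal_mono (bad_subset A o y j) (measure_ne_top _ _)).trans ?_
  refine (measureReal_union_le _ _).trans ?_
  refine add_le_add le_rfl ?_
  refine (measureReal_biUnion_finset_le _ _).trans ?_
  refine Finset.sum_le_sum fun K hK => ?_
  obtain ⟨hyK, hoK⟩ := (Finset.mem_filter.1 hK).2
  rw [markov w A K o y j hyK hoK]

end ClusterDeletion

open ClusterDeletion in
/-- **The cluster-deletion step closes CIL with the constant `C`.**  Let `Ψ(n, w, A, o, j) ≥ 0` be any
potential bounded by the lightness of some relay (`∃ a ∈ A, Ψ ≤ μ_w{|π(a)| ≤ j}` whenever `A ≠ ∅`, `o ∉ A`).  If every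
instance admits a relay `y ∈ A` with
`μ_w{o ↔ y, |π(y)| ≤ j} + C · Σ_{K ∋ y, K ∌ o} μ_w{C(y) = K} · Ψ(w ∖ K, A ∖ K) ≤ C · Ψ(w, A)`,
then `bad_j ≤ C · μ_w{|π(a)| ≤ j}` for some relay `a`, for every instance and every level (strong induction on
`|A|` through `bad_le_step`). [this work] -/
theorem cumulativeIsolationConst_of_clusterDeletionStep (C : ℝ) (hC : 0 ≤ C)
    (Ψ : (n : ℕ) → (Sym2 (Fin n) → unitInterval) → Finset (Fin n) → Fin n → ℕ → ℝ)
    (hΨnn : ∀ (n : ℕ) (w : Sym2 (Fin n) → unitInterval) (A : Finset (Fin n)) (o : Fin n) (j : ℕ),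
      0 ≤ Ψ n w A o j)
    (hΨle : ∀ (n : ℕ) (w : Sym2 (Fin n) → unitInterval) (A : Finset (Fin n)) (o : Fin n) (j : ℕ),
      A.Nonempty → o ∉ A → ∃ a ∈ A, Ψ n w A o j ≤
        (prodBernoulli w).real {ω : BondConfig (Fin n) | (A.filter fun x => ω ∈ openConn a x).card ≤ j})
    (hstep : ∀ (n : ℕ) (w : Sym2 (Fin n) → unitInterval) (A : Finset (Fin n)) (o : Fin n) (j : ℕ),
      A.Nonempty → o ∉ A → ∃ y ∈ A,
        (prodBernoulli w).real (openConn o y ∩ {ω | (A.filter fun x => ω ∈ openConn y x).card ≤ j}) +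
          C * ∑ K ∈ (Finset.univ : Finset (Finset (Fin n))).filter (fun K => y ∈ K ∧ o ∉ K),
            (prodBernoulli w).real {ω : BondConfig (Fin n) | openCluster ω y = (K : Set (Fin n))} *
              Ψ n (fun e : Sym2 (Fin n) => if ∃ v ∈ K, v ∈ e then (0 : unitInterval) else w e) (A \ K) o j
        ≤ C * Ψ n w A o j) :
    ∀ (n : ℕ) (w : Sym2 (Fin n) → unitInterval) (A : Finset (Fin n)) (o : Fin n) (j : ℕ),
      A.Nonempty → o ∉ A → ∃ a ∈ A,
        (prodBernoulli w).real {ω : BondConfig (Fin n) |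
            1 ≤ (A.filter fun x => ω ∈ openConn o x).card ∧
              (A.filter fun x => ω ∈ openConn o x).card ≤ j} ≤
          C * (prodBernoulli w).real {ω : BondConfig (Fin n) |
            (A.filter fun x => ω ∈ openConn a x).card ≤ j} := by
  -- the induction claim: `bad ≤ C · Ψ` for every relay set of size `m`
  have main : ∀ (m : ℕ) (n : ℕ) (w : Sym2 (Fin n) → unitInterval) (A : Finset (Fin n)) (o : Fin n) (j : ℕ),
      A.card = m → o ∉ A →
      (prodBernoulli w).real {ω : BondConfig (Fin n) |
          1 ≤ (A.filter fun x => ω ∈ openConn o x).card ∧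
            (A.filter fun x => ω ∈ openConn o x).card ≤ j} ≤ C * Ψ n w A o j := by
    intro m
    induction m using Nat.strong_induction_on with
    | _ m ih =>
      intro n w A o j hm ho
      rcases A.eq_empty_or_nonempty with hAe | hAne
      · -- no relays: the bad event is empty
        have hempty : {ω : BondConfig (Fin n) |
            1 ≤ (A.filter fun x => ω ∈ openConn o x).card ∧
              (A.filter fun x => ω ∈ openConn o x).card ≤ j} = ∅ := by
          ext ω
          simp [hAe]
        rw [hempty, measureReal_empty]
        exact mul_nonneg hC (hΨnn n w A o j)
      · obtain ⟨y, hyA, hy⟩ := hstep n w A o j hAne ho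
        refine (bad_le_step w A o y j).trans (le_trans ?_ hy)
        refine add_le_add le_rfl ?_
        rw [Finset.mul_sum]
        refine Finset.sum_le_sum fun K hK => ?_
        obtain ⟨hyK, hoK⟩ := (Finset.mem_filter.1 hK).2
        have hcard : (A \ K).card < m := by
          rw [← hm]
          apply Finset.card_lt_card
          refine Finset.ssubset_iff_subset_ne.2 ⟨Finset.sdiff_subset, fun h => ?_⟩
          have : y ∈ A \ K := by rw [h]; exact hyA
          exact (Finset.mem_sdiff.1 this).2 hyK
        have hoAK : o ∉ A \ K := fun h => ho (Finset.mem_sdiff.1 h).1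
        have hsub := ih _ hcard n
          (fun e : Sym2 (Fin n) => if ∃ v ∈ K, v ∈ e then (0 : unitInterval) else w e) (A \ K) o j rfl hoAK
        have hPnn : 0 ≤ (prodBernoulli w).real
            {ω : BondConfig (Fin n) | openCluster ω y = (K : Set (Fin n))} := measureReal_nonneg
        calc (prodBernoulli w).real {ω : BondConfig (Fin n) | openCluster ω y = (K : Set (Fin n))} *
              (prodBernoulli (fun e : Sym2 (Fin n) =>
                  if ∃ v ∈ K, v ∈ e then (0 : unitInterval) else w e)).real
                {ω : BondConfig (Fin n) | 1 ≤ ((A \ K).filter fun x => ω ∈ openConn o x).card ∧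
                  ((A \ K).filter fun x => ω ∈ openConn o x).card ≤ j}
            ≤ (prodBernoulli w).real {ω : BondConfig (Fin n) | openCluster ω y = (K : Set (Fin n))} *
                (C * Ψ n (fun e : Sym2 (Fin n) => if ∃ v ∈ K, v ∈ e then (0 : unitInterval) else w e)
                  (A \ K) o j) := mul_le_mul_of_nonneg_left hsub hPnn
          _ = C * ((prodBernoulli w).real {ω : BondConfig (Fin n) | openCluster ω y = (K : Set (Fin n))} *
                Ψ n (fun e : Sym2 (Fin n) => if ∃ v ∈ K, v ∈ e then (0 : unitInterval) else w e)
                  (A \ K) o j) := by ring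
  intro n w A o j hA ho
  obtain ⟨a, ha, hle⟩ := hΨle n w A o j hA ho
  exact ⟨a, ha, (main A.card n w A o j rfl ho).trans (mul_le_mul_of_nonneg_left hle hC)⟩

/-- **The cluster-deletion step, for any admissible potential and any constant `C ≥ 0`, closes the crux
`NoHeavyLowerTail`** (through `noHeavyLowerTail_of_cumulativeIsolationConst_allLevels`).  Typed `exact` target for the
cell's potentials (PL-block / block-champion `E[max_{c ∈ π(o)} μ{|π(c)| ≤ j}; N ≥ 1]`, pattern-lightest, …): prove the
three hypotheses for your `Ψ`. [this work] -/
theorem noHeavyLowerTail_of_clusterDeletionStep (C : ℝ) (hC : 0 ≤ C)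
    (Ψ : (n : ℕ) → (Sym2 (Fin n) → unitInterval) → Finset (Fin n) → Fin n → ℕ → ℝ)
    (hΨnn : ∀ (n : ℕ) (w : Sym2 (Fin n) → unitInterval) (A : Finset (Fin n)) (o : Fin n) (j : ℕ),
      0 ≤ Ψ n w A o j)
    (hΨle : ∀ (n : ℕ) (w : Sym2 (Fin n) → unitInterval) (A : Finset (Fin n)) (o : Fin n) (j : ℕ),
      A.Nonempty → o ∉ A → ∃ a ∈ A, Ψ n w A o j ≤
        (prodBernoulli w).real {ω : BondConfig (Fin n) | (A.filter fun x => ω ∈ openConn a x).card ≤ j})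
    (hstep : ∀ (n : ℕ) (w : Sym2 (Fin n) → unitInterval) (A : Finset (Fin n)) (o : Fin n) (j : ℕ),
      A.Nonempty → o ∉ A → ∃ y ∈ A,
        (prodBernoulli w).real (openConn o y ∩ {ω | (A.filter fun x => ω ∈ openConn y x).card ≤ j}) +
          C * ∑ K ∈ (Finset.univ : Finset (Finset (Fin n))).filter (fun K => y ∈ K ∧ o ∉ K),
            (prodBernoulli w).real {ω : BondConfig (Fin n) | openCluster ω y = (K : Set (Fin n))} *
              Ψ n (fun e : Sym2 (Fin n) => if ∃ v ∈ K, v ∈ e then (0 : unitInterval) else w e) (A \ K) o j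
        ≤ C * Ψ n w A o j) :
    Summit.CriticalPhenomena.PercolationContinuityZ3.Theses.PercNearOneGluing.NoHeavyLowerTail :=
  noHeavyLowerTail_of_cumulativeIsolationConst_allLevels C hC
    (cumulativeIsolationConst_of_clusterDeletionStep C hC Ψ hΨnn hΨle hstep)

end

end Summit.CriticalPhenomena.PercolationContinuityZ3.Theorems
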